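import Summits.HubbardSuperconductivity.HubbardLadder.Bounds.NumberConservingGaugeFunctionBoundSymm
import Summits.HubbardSuperconductivity.HubbardLadder.Bounds.GaugeStiffnessCeiling
import HarnessLib

/-!
# Bounds node: the gauge-function (resistor-network) STIFFNESS CEILING for the full number-conserving
class on an arbitrary finite hopping graph, `T > 0` and `T = 0`

HONEST FRAMING: ladder R1–R4 with certified numbers; no claim on H/H₀. This file states and proves
BOUNDS FOR A MODEL CLASS (bounds.tex Theorem 4, general form); no materials claim.

Setting (as in `Bounds/NumberConservingGaugeFunctionBound.lean`): `Λ` a finite linearly ordered site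
set, `t : Λ → Λ → ℝ` symmetric real hopping amplitudes (`H` contains `Σ_{x,y,σ} t_{xy} c†_{xσ}c_{yσ}`,
so `t_{xy} = −t_b` for the physical hopping `t_b`), `V` ANY Hermitian interaction commuting with every
site-phase gauge `W_φ` (integrated `[V, n_x] = 0 ∀x`; NO reality / time-reversal hypothesis), and a
TWIST ONE-FORM `d : Λ → Λ → ℝ` antisymmetric (for a torus threaded by flux `θ`: `d_{xy} = ±1` on the
seam bonds, or `(y₁ − x₁)/L` in the uniform gauge; the nodes hold for every `d`). The twisted
Hamiltonian is `H(θ) = bdgHopping (t e^{iθd}) + V`, `H₀ = H(0)`.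

Nodes (both THEOREMS, proved below from the reality-free symmetrised gauge-function bounds
`SymmThermalGaugeFunctionBoundNumberConserving` / `SymmGaugeFunctionBoundNumberConserving` and the
elementary `θ → 0` lemma `mul_sq_le_sum_of_forall_oneSubCos` of `Bounds/GaugeStiffnessCeiling.lean`):

* `ThermalStiffnessCeilingNumberConserving` (`T > 0`): if, in a coordinate sector `p` and for
  `|θ| ≤ θ₀`, the sector free energy rises at least quadratically,
  `β ρ θ² ≤ log Z_p(H₀) − log Z_p(H(θ))`, then for EVERY gauge function `χ : Λ → ℝ`
  `ρ ≤ ½ Σ_{x,y,σ} (d_{xy} + χ_y − χ_x)² · (−t_{xy} Re⟨(c†_{xσ}c_{yσ})|_p⟩_{β,p})`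
  — the thermal bond kinetic energies are the conductances of PTR's resistor network, `d + dχ` the
  trial potential drop; `χ = 0` is the f-sum (kinetic-energy) ceiling, the infimum over `χ` is the
  network (Dirichlet) ceiling of bounds.tex Theorem 4. SHARPENED w.r.t. PTR98/HVR19: exact signed bond
  weights (no positive parts), `ρ` of either sign, every sector, complex number-conserving `V`.
* `StiffnessCeilingNumberConserving` (`T = 0`): the same with joint `(N, S^z)`-sector ground-state
  energies `E_{N,M}(H(θ)) − E_{N,M}(H₀) ≥ ρ θ²` and any unit sector ground state `ψ` of `H₀`.

Proof: the hypothesis at `±θ` averaged, the symmetrised gauge-function bound at `u = θd`, `φ = θχ`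
(so that `cos(u + dφ) = cos(θ(d + dχ))`), division by `β`, and `mul_sq_le_sum_of_forall_oneSubCos`
(`1 − cos a = a²/2 + O(a⁴)` uniformly on the finitely many bonds, `θ → 0`).

References: Paramekanti–Trivedi–Randeria, PRB 57, 11639 (1998) §IV [PTR98];
Hazra–Verma–Randeria, PRX 9, 031049 (2019) [HVR19]; bounds.tex Theorem 4 / Definition `def:class`.
-/

namespace Summit.HubbardSuperconductivity.HubbardLadder.Bounds

open Matrix Finset Literature.MathematicalPhysics.QuantumLattice
  Literature.MathematicalPhysics.QuantumFieldTheory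

open scoped ComplexConjugate ComplexOrder

/-- **Node (THEOREM, proved below): gauge-function stiffness ceiling, full number-conserving class,
any finite hopping graph, `T > 0`.** For symmetric real `t`, antisymmetric `d`, Hermitian
site-phase-gauge-invariant `V`, `β > 0`, a coordinate sector `p`, `θ₀ > 0` and a real `ρ` with
`β ρ θ² ≤ log Z_p(H₀) − log Z_p(H(θ))` for `|θ| ≤ θ₀`: for every `χ : Λ → ℝ`,
`ρ ≤ Σ_{x,y,σ} (d_{xy} + χ_y − χ_x)² (−t_{xy} Re⟨(c†_{xσ}c_{yσ})|_p⟩_{β,p}) / 2`. -/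
@[conjecture] def ThermalStiffnessCeilingNumberConserving : Prop :=
  ∀ (Λ : Type) [LinearOrder Λ] [Fintype Λ] (t d : Λ → Λ → ℝ), (∀ x y, t y x = t x y) →
    (∀ x y, d y x = -d x y) → ∀ (V : Matrix (Finset (Orb Λ)) (Finset (Orb Λ)) ℂ), V.IsHermitian →
    (∀ φ : Λ → ℝ, (phaseGauge fun x => Circle.exp (φ x))ᴴ * V * phaseGauge (fun x => Circle.exp (φ x)) = V) →
    ∀ (β : ℝ), 0 < β → ∀ (p : Finset (Orb Λ) → Prop) [Fintype {a // p a}] [DecidableEq {a // p a}]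
      (ρ θ₀ : ℝ), 0 < θ₀ →
      (∀ θ : ℝ, |θ| ≤ θ₀ →
        β * (ρ * θ ^ 2) ≤
          Real.log (partitionFn β ((bdgHopping (fun x y => (t x y : ℂ)) + V).toBlock p p)).re -
            Real.log (partitionFn β
              ((bdgHopping (fun x y => (t x y : ℂ) * Complex.exp (((θ * d x y : ℝ) : ℂ) * Complex.I)) +
                  V).toBlock p p)).re) →
      ∀ χ : Λ → ℝ,
        ρ ≤ ∑ x : Λ, ∑ y : Λ, ∑ σ : Fin 2, (d x y + (χ y - χ x)) ^ 2 *
          (-(t x y * (gibbsState β ((bdgHopping (fun x y => (t x y : ℂ)) + V).toBlock p p)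
            ((creation (orb x σ) * annihilation (orb y σ)).toBlock p p)).re) / 2)

/-- **Node (THEOREM, proved below): gauge-function stiffness ceiling, full number-conserving class,
any finite hopping graph, `T = 0`.** For symmetric real `t`, antisymmetric `d`, Hermitian
site-phase-gauge-invariant `V`, a joint sector `(N, S^z = M)`, `θ₀ > 0` and a real `ρ` with
`ρ θ² ≤ E_{N,M}(H(θ)) − E_{N,M}(H₀)` for `|θ| ≤ θ₀`: for every unit sector ground state `ψ` of `H₀`
and every `χ : Λ → ℝ`, `ρ ≤ Σ_{x,y,σ} (d_{xy} + χ_y − χ_x)² (−t_{xy} Re⟨ψ, c†_{xσ}c_{yσ} ψ⟩) / 2`. -/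
@[conjecture] def StiffnessCeilingNumberConserving : Prop :=
  ∀ (Λ : Type) [LinearOrder Λ] [Fintype Λ] (t d : Λ → Λ → ℝ), (∀ x y, t y x = t x y) →
    (∀ x y, d y x = -d x y) → ∀ (V : Matrix (Finset (Orb Λ)) (Finset (Orb Λ)) ℂ), V.IsHermitian →
    (∀ φ : Λ → ℝ, (phaseGauge fun x => Circle.exp (φ x))ᴴ * V * phaseGauge (fun x => Circle.exp (φ x)) = V) →
    ∀ (N : ℕ) (M ρ θ₀ : ℝ), 0 < θ₀ →
      (∀ θ : ℝ, |θ| ≤ θ₀ →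
        ρ * θ ^ 2 ≤
          ((bdgHopping fun x y => (t x y : ℂ) * Complex.exp (((θ * d x y : ℝ) : ℂ) * Complex.I)) +
                V).minEnergyOn (szSector N M) -
            ((bdgHopping fun x y => (t x y : ℂ)) + V).minEnergyOn (szSector N M)) →
      ∀ ψ : Fock (Orb Λ), IsGroundStateInSector ((bdgHopping fun x y => (t x y : ℂ)) + V) N M ψ →
        star ψ ⬝ᵥ ψ = 1 → ∀ χ : Λ → ℝ,
        ρ ≤ ∑ x : Λ, ∑ y : Λ, ∑ σ : Fin 2, (d x y + (χ y - χ x)) ^ 2 *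
          (-(t x y * (star ψ ⬝ᵥ ((creation (orb x σ) * annihilation (orb y σ)) *ᵥ ψ)).re) / 2)

variable {Λ : Type} [LinearOrder Λ] [Fintype Λ]

omit [LinearOrder Λ] in
/-- `mul_sq_le_sum_of_forall_oneSubCos` (the `θ → 0` limit) for a family indexed by `Λ × Λ × Fin 2`,
written with iterated sums. -/
theorem le_sum₃_of_forall_oneSubCos {ρ θ₁ : ℝ} (hθ₁ : 0 < θ₁) (w a : Λ → Λ → Fin 2 → ℝ)
    (h : ∀ θ : ℝ, 0 < θ → θ ≤ θ₁ →
      ρ * θ ^ 2 ≤ ∑ x : Λ, ∑ y : Λ, ∑ σ : Fin 2, 2 * (1 - Real.cos (θ * a x y σ)) * w x y σ) :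
    ρ ≤ ∑ x : Λ, ∑ y : Λ, ∑ σ : Fin 2, a x y σ ^ 2 * w x y σ := by
  have key := mul_sq_le_sum_of_forall_oneSubCos (ι := Λ × Λ × Fin 2) one_pos hθ₁
    (fun i => w i.1 i.2.1 i.2.2) (fun i => a i.1 i.2.1 i.2.2) fun θ hθ hθ1 => by
      simpa only [div_one, Fintype.sum_prod_type] using h θ hθ hθ1
  simpa only [one_pow, mul_one, Fintype.sum_prod_type] using key

/-- From the symmetrised thermal gauge-function bound at `u = θd`, `φ = θχ` and the two-sided
stiffness hypothesis: `ρ θ² ≤ Σ 2(1 − cos(θ(d + dχ))) · (−t Re⟨c†c⟩_{β,p} / 2)` for `0 < θ ≤ θ₀`. -/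
theorem mul_sq_le_sum_oneSubCos_thermal {t d : Λ → Λ → ℝ} (ht : ∀ x y, t y x = t x y)
    (hd : ∀ x y, d y x = -d x y) {V : Matrix (Finset (Orb Λ)) (Finset (Orb Λ)) ℂ}
    (hV : V.IsHermitian)
    (hVg : ∀ φ : Λ → ℝ,
      (phaseGauge fun x => Circle.exp (φ x))ᴴ * V * phaseGauge (fun x => Circle.exp (φ x)) = V)
    {β : ℝ} (hβ : 0 < β) (p : Finset (Orb Λ) → Prop) [Fintype {a // p a}] [DecidableEq {a // p a}]
    {ρ θ₀ : ℝ}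
    (hstiff : ∀ θ : ℝ, |θ| ≤ θ₀ →
      β * (ρ * θ ^ 2) ≤
        Real.log (partitionFn β ((bdgHopping (fun x y => (t x y : ℂ)) + V).toBlock p p)).re -
          Real.log (partitionFn β
            ((bdgHopping (fun x y => (t x y : ℂ) * Complex.exp (((θ * d x y : ℝ) : ℂ) * Complex.I)) +
                V).toBlock p p)).re)
    (χ : Λ → ℝ) {θ : ℝ} (hθ : 0 < θ) (hθ1 : θ ≤ θ₀) :
    ρ * θ ^ 2 ≤ ∑ x : Λ, ∑ y : Λ, ∑ σ : Fin 2,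
      2 * (1 - Real.cos (θ * (d x y + (χ y - χ x)))) *
        (-(t x y * (gibbsState β ((bdgHopping (fun x y => (t x y : ℂ)) + V).toBlock p p)
          ((creation (orb x σ) * annihilation (orb y σ)).toBlock p p)).re) / 2) := by
  have hs := symmThermalGaugeFunctionBoundNumberConserving_holds Λ t (fun x y => θ * d x y) ht
    (fun x y => by rw [hd x y]; ring) V hV hVg β p (fun x => θ * χ x)
  beta_reduce at hs
  have hp := hstiff θ (by rwa [abs_of_pos hθ])
  have hm := hstiff (-θ) (by rwa [abs_neg, abs_of_pos hθ])
  simp only [neg_mul, neg_sq] at hm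
  have hβG : β * (ρ * θ ^ 2) ≤ β * -(∑ x : Λ, ∑ y : Λ, ∑ σ : Fin 2,
      t x y * (1 - Real.cos (θ * d x y + (θ * χ y - θ * χ x))) *
        (gibbsState β ((bdgHopping (fun x y => (t x y : ℂ)) + V).toBlock p p)
          ((creation (orb x σ) * annihilation (orb y σ)).toBlock p p)).re) := by
    linarith
  refine (le_of_mul_le_mul_left hβG hβ).trans (le_of_eq ?_)
  rw [← Finset.sum_neg_distrib]
  refine Finset.sum_congr rfl fun x _ => ?_
  rw [← Finset.sum_neg_distrib]
  refine Finset.sum_congr rfl fun y _ => ?_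
  rw [← Finset.sum_neg_distrib]
  refine Finset.sum_congr rfl fun σ _ => ?_
  rw [show θ * (d x y + (χ y - χ x)) = θ * d x y + (θ * χ y - θ * χ x) by ring]
  ring

/-- From the symmetrised `T = 0` gauge-function bound at `u = θd`, `φ = θχ` and the two-sided
stiffness hypothesis: `ρ θ² ≤ Σ 2(1 − cos(θ(d + dχ))) · (−t Re⟨ψ, c†c ψ⟩ / 2)` for `0 < θ ≤ θ₀`. -/
theorem mul_sq_le_sum_oneSubCos_ground {t d : Λ → Λ → ℝ} (ht : ∀ x y, t y x = t x y)
    (hd : ∀ x y, d y x = -d x y) {V : Matrix (Finset (Orb Λ)) (Finset (Orb Λ)) ℂ}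
    (hV : V.IsHermitian)
    (hVg : ∀ φ : Λ → ℝ,
      (phaseGauge fun x => Circle.exp (φ x))ᴴ * V * phaseGauge (fun x => Circle.exp (φ x)) = V)
    {N : ℕ} {M ρ θ₀ : ℝ}
    (hstiff : ∀ θ : ℝ, |θ| ≤ θ₀ →
      ρ * θ ^ 2 ≤
        ((bdgHopping fun x y => (t x y : ℂ) * Complex.exp (((θ * d x y : ℝ) : ℂ) * Complex.I)) +
              V).minEnergyOn (szSector N M) -
          ((bdgHopping fun x y => (t x y : ℂ)) + V).minEnergyOn (szSector N M))
    {ψ : Fock (Orb Λ)} (hgs : IsGroundStateInSector ((bdgHopping fun x y => (t x y : ℂ)) + V) N M ψ)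
    (h1 : star ψ ⬝ᵥ ψ = 1) (χ : Λ → ℝ) {θ : ℝ} (hθ : 0 < θ) (hθ1 : θ ≤ θ₀) :
    ρ * θ ^ 2 ≤ ∑ x : Λ, ∑ y : Λ, ∑ σ : Fin 2,
      2 * (1 - Real.cos (θ * (d x y + (χ y - χ x)))) *
        (-(t x y * (star ψ ⬝ᵥ ((creation (orb x σ) * annihilation (orb y σ)) *ᵥ ψ)).re) / 2) := by
  have hs := symmGaugeFunctionBoundNumberConserving_holds Λ t (fun x y => θ * d x y) ht
    (fun x y => by rw [hd x y]; ring) V hV hVg N M ψ hgs h1 (fun x => θ * χ x)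
  beta_reduce at hs
  have hp := hstiff θ (by rwa [abs_of_pos hθ])
  have hm := hstiff (-θ) (by rwa [abs_neg, abs_of_pos hθ])
  simp only [neg_mul, neg_sq] at hm
  have hG : ρ * θ ^ 2 ≤ -(∑ x : Λ, ∑ y : Λ, ∑ σ : Fin 2,
      t x y * (1 - Real.cos (θ * d x y + (θ * χ y - θ * χ x))) *
        (star ψ ⬝ᵥ ((creation (orb x σ) * annihilation (orb y σ)) *ᵥ ψ)).re) := by
    linarith
  refine hG.trans (le_of_eq ?_)
  rw [← Finset.sum_neg_distrib]
  refine Finset.sum_congr rfl fun x _ => ?_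
  rw [← Finset.sum_neg_distrib]
  refine Finset.sum_congr rfl fun y _ => ?_
  rw [← Finset.sum_neg_distrib]
  refine Finset.sum_congr rfl fun σ _ => ?_
  rw [show θ * (d x y + (χ y - χ x)) = θ * d x y + (θ * χ y - θ * χ x) by ring]
  ring

/-- `ThermalStiffnessCeilingNumberConserving` holds. -/
theorem thermalStiffnessCeilingNumberConserving_holds : ThermalStiffnessCeilingNumberConserving := by
  intro Λ _ _ t d ht hd V hV hVg β hβ p _ _ ρ θ₀ hθ₀ hstiff χ
  exact le_sum₃_of_forall_oneSubCos hθ₀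
    (fun x y σ => -(t x y * (gibbsState β ((bdgHopping (fun x y => (t x y : ℂ)) + V).toBlock p p)
      ((creation (orb x σ) * annihilation (orb y σ)).toBlock p p)).re) / 2)
    (fun x y _ => d x y + (χ y - χ x))
    fun θ hθ hθ1 => mul_sq_le_sum_oneSubCos_thermal ht hd hV hVg hβ p hstiff χ hθ hθ1

/-- `StiffnessCeilingNumberConserving` holds. -/
theorem stiffnessCeilingNumberConserving_holds : StiffnessCeilingNumberConserving := by
  intro Λ _ _ t d ht hd V hV hVg N M ρ θ₀ hθ₀ hstiff ψ hgs h1 χ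
  exact le_sum₃_of_forall_oneSubCos hθ₀
    (fun x y σ => -(t x y * (star ψ ⬝ᵥ ((creation (orb x σ) * annihilation (orb y σ)) *ᵥ ψ)).re) / 2)
    (fun x y _ => d x y + (χ y - χ x))
    fun θ hθ hθ1 => mul_sq_le_sum_oneSubCos_ground ht hd hV hVg hstiff hgs h1 χ hθ hθ1

end Summit.HubbardSuperconductivity.HubbardLadder.Bounds
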